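import Summits.Ventures.PercRepro.Night4TrST5C13Q5M0P0
import Summits.Ventures.PercRepro.Night4TrST5C13Q5M0P1
import Summits.Ventures.PercRepro.Night4TrST5C13Q5M0P2
import Summits.Ventures.PercRepro.Night4TrST5C13Q5M0T

/-!
# PercRepro — the `(9, 7)` trace sum at type `5` on a rank-`5` subset of the core, corank `13`, `m(G) = 0`: the certificate (night-4 gen 4)
The facts of the cyclic-rank profile (P1)–(P3), the line facts (L1)–(L5), the weighted rises (L4), the demand-free levels
`0 … 4` at type `5`, the facts of the core (lines `≤ 3` points, planes `≤ 6`, solids `≤ 10`, rank-`5` flats `≤ 21`),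
and the `t = 5` rows of night-4 gen 4 — the solid atoms `N4`/`B4` with (S1s) `#Pc k (q−4) ≤ Σ_s C(s, ν+4)·B4 s` and
(S5s) `B4 s ≤ C(n−s, q−4)·N4 s`, the solid demand-free rows (R5a) `DF₅ ≥ Σ_{k<5} i_k + 166·N4 10 + 20·N4 9` and
(R5b) `DF₅ + C(n,5) ≥ Σ_{k≤5} i_k + 37·N4 8 + 96·N4 9 + 209·N4 10`, the plane stays (R3), the trace-pair row (R1) and the
trace-triple row (R2) — instantiated in `ℚ`, and the exact dual certificate of the LP (`mining/night-4/g4/leanlp_q.py`)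
checked by `linear_combination`.
-/
namespace PercRepro.Night4

open Finset ThmH SixFour GenQ PerFlat Star

variable {α : Type*} [DecidableEq α] {M : Matroid α} [M.Finite]

/-- **the `(9, 7)` trace sum at type `5` on a rank-`5` subset of the core, corank `13`, `m(G) = 0`** (SHIFTED: the coloop of the ambient set removed, weights `1/(3 + m)`): the exact dual certificate, `8·TS' ≥ 236832780563/1355315`. -/
theorem traceSumShift_nonneg_t5_c13_q5_m0 (hs : Simple M) (hline : ∀ L ∈ flatsQ M 2, L.card ≤ 3) (hplane : ∀ P ∈ flatsQ M 3, P.card ≤ 6) (hsolid : ∀ F ∈ flatsQ M 4, F.card ≤ 10) (hflat5 : ∀ F ∈ flatsQ M 5, F.card ≤ 21) (hflat6 : ∀ F ∈ flatsQ M 6, F.card ≤ 43) {G : Finset α} (hG : G ⊆ gr M) (hrG : M.eRk (G : Set α) = ((5 : ℕ) : ℕ∞)) (hcard : G.card = 5 + 13) (hmG : mTr M G = 0) : 0 ≤ ∑ B ∈ Rq M G 5, ((((7 : ℕ) : ℚ) + 2 - ((5 : ℕ) : ℚ)) * (1 / (3 + (mTr M B : ℚ))) - ((((7 : ℕ) :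 ℚ) + 2) / (((7 : ℕ) : ℚ) + 1)) * GenQ.dem M G 5 B) := by
  have hpos : (0 : ℚ) < ((7 : ℕ) : ℚ) + 1 := by norm_num
  suffices hmain : 0 ≤ (((7 : ℕ) : ℚ) + 1) * ∑ B ∈ Rq M G 5, ((((7 : ℕ) : ℚ) + 2 - ((5 : ℕ) : ℚ)) * (1 / (3 + (mTr M B : ℚ))) - ((((7 : ℕ) : ℚ) + 2) / (((7 : ℕ) : ℚ) + 1)) * GenQ.dem M G 5 B) from
    le_of_mul_le_mul_left (by rw [mul_zero]; exact hmain) hpos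
  have e_0_5 : Finset.Icc (0 : ℕ) 5 = {0, 1, 2, 3, 4, 5} := by
    ext x; simp only [Finset.mem_Icc, Finset.mem_insert, Finset.mem_singleton]; omega
  have hsum : ∀ f : ℕ → ℚ, ∑ m ∈ Finset.Icc (0 : ℕ) 5, f m = f 0 + f 1 + f 2 + f 3 + f 4 + f 5 := by
    intro f
    rw [e_0_5, Finset.sum_insert (by simp), Finset.sum_insert (by simp), Finset.sum_insert (by simp), Finset.sum_insert (by simp), Finset.sum_insert (by simp), Finset.sum_singleton]
    ring
  rw [traceSumShift_mul_eq_profile hG hrG hcard 7 5, hmG]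
  simp only [hsum, Finset.sum_range_succ, Finset.sum_range_zero]
  push_cast
  norm_num
  have t0 := trst5c13_q5_m0_cert_0 hs hline hplane hsolid hflat5 hflat6 hG hrG hcard hmG
  have t1 := trst5c13_q5_m0_cert_1 hs hline hplane hsolid hflat5 hflat6 hG hrG hcard hmG
  have t2 := trst5c13_q5_m0_cert_2 hs hline hplane hsolid hflat5 hflat6 hG hrG hcard hmG
  have t3 := trst5c13_q5_m0_cert_3 hs hline hplane hsolid hflat5 hflat6 hG hrG hcard hmG
  have t4 := trst5c13_q5_m0_cert_4 hs hline hplane hsolid hflat5 hflat6 hG hrG hcard hmG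
  have t5 := trst5c13_q5_m0_cert_5 hs hline hplane hsolid hflat5 hflat6 hG hrG hcard hmG
  have t6 := trst5c13_q5_m0_cert_6 hs hline hplane hsolid hflat5 hflat6 hG hrG hcard hmG
  have t7 := trst5c13_q5_m0_cert_7 hs hline hplane hsolid hflat5 hflat6 hG hrG hcard hmG
  have t8 := trst5c13_q5_m0_cert_8 hs hline hplane hsolid hflat5 hflat6 hG hrG hcard hmG
  have t9 := trst5c13_q5_m0_cert_9 hs hline hplane hsolid hflat5 hflat6 hG hrG hcard hmG
  have t10 := trst5c13_q5_m0_cert_10 hs hline hplane hsolid hflat5 hflat6 hG hrG hcard hmG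
  have t11 := trst5c13_q5_m0_cert_11 hs hline hplane hsolid hflat5 hflat6 hG hrG hcard hmG
  have t12 := trst5c13_q5_m0_cert_12 hs hline hplane hsolid hflat5 hflat6 hG hrG hcard hmG
  have ttop := trst5c13_q5_m0_cert_top hs hline hplane hsolid hflat5 hflat6 hG hrG hcard hmG
  linear_combination t0 + t1 + t2 + t3 + t4 + t5 + t6 + t7 + t8 + t9 + t10 + t11 + t12 + ttop

end PercRepro.Night4
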